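import Literature.Probability.Percolation.CardyFormula
import Literature.Probability.Percolation.BoxArcStateReading

/-!
# Limit duality for conjugate markings of a conformal rectangle (stub `stub_limitDuality`)

Sub-goal (B) of the `SimilarityUpgrade` crux (lead c4): if the G02 discretisation of bond
percolation on `ℤ²` at `p = 1/2` is *limit self-dual* — for every conformal rectangle `R`,
`P[C_δ(R; arc 0, arc 2)] + P[C_δ(R; arc 1, arc 3)] → 1` as `δ → 0⁺` — and `Φ` is the full
`δ → 0⁺` limit of the crossing probabilities `bondDomainCrossingProb`, then `Φ R + Φ R' = 1`
whenever `R'` has the same carrier as `R` and is marked by the conjugate pair of arcs (in either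
order).

Proof sketch: `bondDomainCrossingProb R δ` is by definition
`discreteCrossingProb half R.carrier δ (R.arc 0) (R.arc 2)`, so after rewriting the carrier and
the arcs of `R'` (and, in the reversed orientation, using the symmetry
`discreteCrossing_comm` of the crossing event in its two arcs) the dual sum at `R` reads
`bondDomainCrossingProb R δ + bondDomainCrossingProb R' δ → 1`; the full-limit hypothesis gives
`→ Φ R + Φ R'`, and limits along the non-trivial filter `𝓝[>] 0` are unique.

References: S. Smirnov, *Critical percolation in the plane*, C. R. Acad. Sci. Paris 333 (2001),
§2; G. R. Grimmett, *Percolation* (1999), §9.7 and Lemma 11.21 (self-duality at `p = 1/2`).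
-/

noncomputable section

namespace Summit.CriticalPhenomena.CardyFormulaZ2.Cruxes.SimilarityUpgrade.Stubs

open Filter Topology Set MeasureTheory
open Literature.Probability.RandomPlanarGeometry
open Literature.Probability.Percolation

/-- The crossing probability of a conformal rectangle is symmetric in its two marked arcs
(open paths reverse). [folklore] -/
theorem discreteCrossingProb_arc_swap (p : unitInterval) (Ω : Set ℂ) (δ : ℝ) (A B : Set ℂ) :
    discreteCrossingProb p Ω δ A B = discreteCrossingProb p Ω δ B A := by
  unfold discreteCrossingProb
  rw [discreteCrossing_comm]

/-- **Limit duality.** If the G02 discretisation is limit self-dual on every conformal rectangle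
and `Φ` is the full `δ → 0⁺` limit of the bond-`ℤ²` crossing probabilities, then the limits of a
marking and of its conjugate marking (same carrier, arcs `1, 3` in either order) sum to `1`.
[folklore] -/
theorem stub_limitDuality :
    (∀ R : ConformalRectangle, Tendsto (fun δ : ℝ => bondDomainCrossingProb R δ +
      discreteCrossingProb half R.carrier δ (R.arc 1) (R.arc 3)) (𝓝[>] (0 : ℝ)) (𝓝 1)) →
    ∀ Φ : ConformalRectangle → ℝ,
      (∀ R : ConformalRectangle, Tendsto (bondDomainCrossingProb R) (𝓝[>] (0 : ℝ)) (𝓝 (Φ R))) →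
      ∀ R R' : ConformalRectangle, R'.carrier = R.carrier →
        (R'.arc 0 = R.arc 1 ∧ R'.arc 2 = R.arc 3 ∨ R'.arc 0 = R.arc 3 ∧ R'.arc 2 = R.arc 1) →
        Φ R + Φ R' = 1 := by
  intro hDual Φ hΦ R R' hcar harcs
  -- The conjugate marking `R'` computes the dual crossing probability of `R`.
  have hR' : ∀ δ : ℝ, bondDomainCrossingProb R' δ =
      discreteCrossingProb half R.carrier δ (R.arc 1) (R.arc 3) := by
    intro δ
    unfold bondDomainCrossingProb
    rcases harcs with ⟨h0, h2⟩ | ⟨h0, h2⟩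
    · rw [hcar, h0, h2]
    · rw [hcar, h0, h2, discreteCrossingProb_arc_swap]
  -- Dual sum at `R`, rewritten: `bond R δ + bond R' δ → 1`.
  have hOne : Tendsto (fun δ : ℝ => bondDomainCrossingProb R δ + bondDomainCrossingProb R' δ)
      (𝓝[>] (0 : ℝ)) (𝓝 1) :=
    (hDual R).congr fun δ => by rw [hR' δ]
  -- Full limits: `bond R δ + bond R' δ → Φ R + Φ R'`.
  have hLim : Tendsto (fun δ : ℝ => bondDomainCrossingProb R δ + bondDomainCrossingProb R' δ)
      (𝓝[>] (0 : ℝ)) (𝓝 (Φ R + Φ R')) :=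
    (hΦ R).add (hΦ R')
  exact tendsto_nhds_unique hLim hOne

end Summit.CriticalPhenomena.CardyFormulaZ2.Cruxes.SimilarityUpgrade.Stubs

end
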